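import Literature.NumberTheory.EllipticCurves.OrdinaryTorsionValuationProofs
import Literature.NumberTheory.EllipticCurves.FormalGroupChart
import Literature.NumberTheory.EllipticCurves.NeronIsogenyScalingIsogenyLayerProofs
import Literature.NumberTheory.EllipticCurves.IsogenyHomProofs
import Summits.BirchSwinnertonDyer.Rank1Residual.Partition.EisensteinKernelReductionLine
import HarnessLib

/-!
# The multiplier of an isogeny with étale kernel is a `p`-adic unit — the valuation-theoretic
# core (cell `b2b-bsdres`, unit `b2b-bsdres-eisenstein-p2`, gen 28)

HONEST FRAMING (run/shared/lean/b2b/bsd-rank1-residual/, verbatim in every file): the goal of the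
cell is to DELETE the COMBINATION-SHAPED residual classes of the Birch–Swinnerton-Dyer formula for
ALL analytic-rank `≤ 1` elliptic curves over `ℚ` — "full BSD formula for every rank `≤ 1` curve in
class `C`" assembled STRICTLY from published theorems — so that the rank-`≤ 1` remainder becomes
exactly the CONSTRUCTION-SHAPED classes, which are TYPED (missing-input `Prop`s), NOT attempted.
This is not "finishing BSD". Research route; NO CLAIM BEYOND STATED CLASSES; nothing here changes
a label. Theorems only; no definition, no named fact.

WHY. The `p`-ADIC half of the kernel derivation of Greenberg–Vatsal's period clause Cor. (3.8)
(registered fact A180, binder `hP` of the X2a closure term): **an isogeny `g : E → E'` between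
globally minimal models whose kernel `S` consists of `𝔓`-INTEGRAL `p`-torsion points (an étale,
i.e. unramified, rational `p`-line — `X2/UnramifiedLineIntegral`) has a multiplier `k` prime to
`p`**, provided `g` is "Vélu-shaped": `x(gP) = μ · Σ_{s ∈ S} x(P + s) + ρ` off `S` (the quotient
construction of the tree, `IsogenyQuotientCurveProofs`, followed by a change of variables) and
`x(gP) = A(x)/B(x)` with `lc A = k⁻²` (the analytic multiplier, `X2/IsogenyKernelRealPoints`).
Printed form: T. & V. Dokchitser, *Local invariants of isogenous elliptic curves*, Trans. AMS 367
(2015), Prop. 16 (good ordinary: `φ^*ω'/ω` is a unit iff `ker φ ⊄ Ê(𝔪)`) and Prop. 18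
(multiplicative, via Tate curves); the argument here is elementary and uniform (no Néron models, no
Tate curves):

* `val_sum_eq_of_one_lt`, `val_sum_le_one` — for `P` in the kernel of reduction `E₁` (`|x(P)| > 1`,
  tree `FormalGroupChart.kernel`) the sum `Σ_{s∈S} x(P+s)` has valuation `|x(P)|`; for a
  `2`-torsion point `T ∉ E₁` it is integral (`E₁` is a subgroup without prime-to-`p` torsion);
* **`not_val_multiplier_le`** — comparing the two formulas for `x(gP)` deep in `E₁` gives
  `|k|⁻² = |μ|`; if `|k| ≤ |p|`, the point `T_c ∈ E₁ ∩ E[p]` (height one: tree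
  `exists_prime_zsmul_eq_zero_one_lt`) and a `2`-torsion point `T` give
  `|x(gT_c) − x(gT)| = |k|⁻²|x(T_c)| > |p|⁻²`, whereas every `p`-torsion point of `E'` has
  `|x| ≤ |p|⁻¹` (`|p|·|x|^{(p-1)/2} = 1`, tree `mul_pow_eq_one_of_prime_zsmul_eq_zero_of_one_lt`):
  contradiction.

References: [DokchitserLocalInvariants2015] Props. 16, 18 and Table 1 (`†`);
[SerreInventiones1972] §1.11; [SilvermanAEC2009] IV.6.1, VII.2–VII.3; [GreenbergVatsal2000] §3
Cor. (3.8) (the consumer); HOME/b2b-bsdres-eisenstein-p2/X2-GAP.md §33.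
-/

set_option autoImplicit false

noncomputable section

open scoped Classical NNReal

open WeierstrassCurve Polynomial
  Literature.NumberTheory.EllipticCurves Literature.NumberTheory.EllipticCurves.FormalGroupChart
  WeierstrassCurve.geomPoints

namespace Summit.BirchSwinnertonDyer.Rank1Residual.X2.IsogenyPeriodRatioCore

universe u

variable {L : Type u} [Field L] {w : Valuation L ℝ≥0} {V : WeierstrassCurve L}

/-! ## §1. Sums over an integral finite subgroup -/

/-- **A point of `E₁` plus an integral point is integral.** If `P ∈ E₁` (kernel of reduction,
`|x| > 1`) and `s ∉ E₁`, `s ≠ O`, then `P + s` is an affine point with `|x(P + s)| ≤ 1`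
(`E₁` is a subgroup, Silverman *AEC* VII.2.2). [cite: SilvermanAEC2009, Prop. VII.2.2] -/
theorem exists_eq_some_val_le_one_of_mem_kernel [hV : V.IsIntegral w.integer]
    {P s : V.toAffine.Point} (hP : P ∈ kernel w V) (hs : s ∉ kernel w V) :
    ∃ (x y : L) (h : V.toAffine.Nonsingular x y), P + s = .some x y h ∧ w x ≤ 1 := by
  have hsum : P + s ∉ kernel w V := fun hmem ↦ hs (by
    have h1 : P + s - P ∈ kernel w V := (kernel w V).sub_mem @hmem @hP
    rwa [add_sub_cancel_left] at h1)
  rcases hR : P + s with _ | ⟨x, y, h⟩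
  · exfalso
    rw [← WeierstrassCurve.Affine.Point.zero_def, add_eq_zero_iff_eq_neg] at hR
    have h1 : -s ∈ kernel w V := by rw [← hR]; exact @hP
    have h2 : s ∈ kernel w V := by
      have h3 : - -s ∈ kernel w V := (kernel w V).neg_mem @h1
      rwa [neg_neg] at h3
    exact hs @h2
  · refine ⟨x, y, h, rfl, ?_⟩
    by_contra hx
    rw [not_le] at hx
    have h1 : P + s ∈ kernel w V := by rw [hR]; exact some_mem_kernel h hx
    exact hsum @h1

/-! ## §2. The core contradiction -/

/-- **The multiplier of an isogeny with `𝔓`-integral `p`-torsion kernel is prime to `p` —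
valuation-theoretic core.**  Setting: `V, V'` Weierstrass equations over a field `L ⊇ ℚ`,
algebraically closed, with a valuation `w` under which both are integral, `p` an odd prime with
`|p| < 1`, `|2| = 1`, and the `p`-division polynomials of `V, V'` of height-one shape
(coefficients `≤ 1`, a unit in degree `(p² − p)/2`, `≤ |p|` above — from `A_p ≠ 0`); `S` a finite
subgroup of `V(L)` killed by `p` whose affine points are integral, `V(L)` having a point of
order `2`; `g : V(L) → V'(L)` additive, of the shape `x(gP) = μ Σ_{s∈S} x(P+s) + ρ` off `S`
(`xc` = the `x`-coordinate, `0` at `O`), and with `x(gP) = A(x)/B(x)` (`B` monic,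
`deg A = deg B + 1`, `lc A = κ`) off `S`.  Then it is NOT the case that `|κ| ≥ |p|⁻²`.  (With
`κ = k⁻²` for the analytic multiplier `k ∈ ℤ`: `p ∤ k`.)
[cite: DokchitserLocalInvariants2015, Prop. 16 and Prop. 18] -/
theorem not_le_val_leadingCoeff [IsAlgClosed L] [CharZero L] [hV : V.IsIntegral w.integer]
    {V' : WeierstrassCurve L} [hV' : V'.IsIntegral w.integer] [V.IsElliptic]
    {p : ℕ} [hp : Fact p.Prime] (hp2 : p ≠ 2) (hpw : w p < 1) (h2 : w (2 : L) = 1)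
    (hd : w ((V.preΨ' p).coeff ((p ^ 2 - p) / 2)) = 1)
    (hcoef' : ∀ i, w ((V'.preΨ' p).coeff i) ≤ 1)
    (hd' : w ((V'.preΨ' p).coeff ((p ^ 2 - p) / 2)) = 1)
    (hhigh' : ∀ i, (p ^ 2 - p) / 2 < i → w ((V'.preΨ' p).coeff i) ≤ w p)
    {S : AddSubgroup V.toAffine.Point} (hSfin : (S : Set V.toAffine.Point).Finite)
    (hSp : ∀ s ∈ S, (p : ℤ) • s = 0)
    (hSint : ∀ s ∈ S, s ∉ kernel w V)
    (hT2 : ∃ T : V.toAffine.Point, T ≠ 0 ∧ (2 : ℤ) • T = 0)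
    (g : V.toAffine.Point →+ V'.toAffine.Point)
    (xc : V.toAffine.Point → L) (hxc0 : xc 0 = 0)
    (hxc : ∀ (x y : L) (h : V.toAffine.Nonsingular x y), xc (.some x y h) = x)
    {μ ρ : L}
    (hcoord : ∀ (x y : L) (h : V.toAffine.Nonsingular x y), (.some x y h : V.toAffine.Point) ∉ S →
      ∃ (x' y' : L) (h' : V'.toAffine.Nonsingular x' y'), g (.some x y h) = .some x' y' h' ∧
        x' = μ * (∑ s ∈ hSfin.toFinset, xc ((Affine.Point.some x y h : V.toAffine.Point) + s)) + ρ)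
    {A B : L[X]} (hBm : B.Monic) (hdeg : A.natDegree = B.natDegree + 1)
    (hform : ∀ (x y : L) (h : V.toAffine.Nonsingular x y), (.some x y h : V.toAffine.Point) ∉ S →
      B.eval x ≠ 0 ∧ ∃ (y' : L) (h' : V'.toAffine.Nonsingular (A.eval x / B.eval x) y'),
        g (.some x y h) = .some (A.eval x / B.eval x) y' h') :
    ¬ (w p)⁻¹ ^ 2 ≤ w A.leadingCoeff := by
  intro hκ
  have hpP : p.Prime := hp.out
  have hpL : (p : L) ≠ 0 := by exact_mod_cast hpP.ne_zero
  have hp0 : w (p : L) ≠ 0 := (Valuation.ne_zero_iff w).mpr hpL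
  have hppos : 0 < w (p : L) := zero_lt_iff.mpr hp0
  -- the `x`-sum attached to a point, and its two evaluations
  set Xs : V.toAffine.Point → L := fun P ↦ ∑ s ∈ hSfin.toFinset, xc (P + s) with hXdef
  have hmemS : ∀ s, s ∈ hSfin.toFinset ↔ s ∈ S := fun s ↦ by
    rw [Set.Finite.mem_toFinset, SetLike.mem_coe]
  have h0S : (0 : V.toAffine.Point) ∈ hSfin.toFinset := (hmemS 0).mpr S.zero_mem
  -- (a) for `P ∈ E₁`: `|X P| = |x(P)|`
  have hXker : ∀ (x y : L) (h : V.toAffine.Nonsingular x y), 1 < w x →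
      w (Xs (.some x y h)) = w x := by
    intro x y h hx
    have hPk : (.some x y h : V.toAffine.Point) ∈ kernel w V := some_mem_kernel h hx
    rw [hXdef]
    simp only
    rw [← Finset.add_sum_erase _ _ h0S, add_zero, hxc]
    have hrest : w (∑ s ∈ hSfin.toFinset.erase 0,
        xc ((Affine.Point.some x y h : V.toAffine.Point) + s)) ≤ 1 := by
      refine Valuation.map_sum_le w fun s hs ↦ ?_
      rw [Finset.mem_erase] at hs
      obtain ⟨x₃, y₃, h₃, hR, hx₃⟩ :=
        exists_eq_some_val_le_one_of_mem_kernel hPk (hSint s ((hmemS s).mp hs.2))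
      rw [hR, hxc]
      exact hx₃
    rw [Valuation.map_add_eq_of_lt_left w (lt_of_le_of_lt hrest hx)]
  -- (b) for the `2`-torsion point `T ∉ E₁`: `|X T| ≤ 1`
  obtain ⟨T, hT0, hT2⟩ := hT2
  obtain ⟨k2, hk2⟩ := hpP.odd_of_ne_two hp2
  rcases hTeq : T with _ | ⟨xT, yT, hT⟩
  · exact (hT0 hTeq).elim
  rw [hTeq] at hT2
  have h2z : w ((2 : ℤ) : L) = 1 := by exact_mod_cast h2
  have hxT : w xT ≤ 1 := val_le_one_of_zsmul_eq_zero (V := V) h2z hT2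
  have hTnk : (.some xT yT hT : V.toAffine.Point) ∉ kernel w V := fun hmem ↦
    absurd ((some_mem_kernel_iff hT).mp hmem) (not_lt.mpr hxT)
  have hpT : (p : ℤ) • (.some xT yT hT : V.toAffine.Point) = .some xT yT hT := by
    rw [hk2]; push_cast
    rw [add_zsmul, one_zsmul, mul_comm, mul_zsmul, hT2, zsmul_zero, zero_add]
  have hTS : (.some xT yT hT : V.toAffine.Point) ∉ S := by
    intro hmem
    have := hSp _ hmem
    rw [hpT] at this
    exact WeierstrassCurve.Affine.Point.some_ne_zero _ this
  have hXT : w (Xs (.some xT yT hT)) ≤ 1 := by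
    rw [hXdef]
    refine Valuation.map_sum_le w fun s hs ↦ ?_
    have hsS : s ∈ S := (hmemS s).mp hs
    -- `T + s ∉ E₁`: else `p • (T + s) = T ∈ E₁`
    have hsum : (.some xT yT hT : V.toAffine.Point) + s ∉ kernel w V := by
      intro hmem
      have h1 : (p : ℤ) • ((.some xT yT hT : V.toAffine.Point) + s) ∈ kernel w V :=
        (kernel w V).zsmul_mem @hmem (p : ℤ)
      rw [smul_add, hSp s hsS, add_zero, hpT] at h1
      exact hTnk @h1
    rcases hR : (Affine.Point.some xT yT hT : V.toAffine.Point) + s with _ | ⟨x₃, y₃, h₃⟩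
    · rw [← WeierstrassCurve.Affine.Point.zero_def, hxc0, map_zero]; exact zero_le
    · rw [hxc]
      by_contra hx₃
      rw [not_le] at hx₃
      have h1 : (Affine.Point.some xT yT hT : V.toAffine.Point) + s ∈ kernel w V := by
        rw [hR]; exact some_mem_kernel h₃ hx₃
      exact hsum @h1
  -- (c) asymptotics: `|lc A| = |μ|`
  have hA0 : A ≠ 0 := by
    intro hA; rw [hA, natDegree_zero] at hdeg; omega
  obtain ⟨MA, hMA⟩ := exists_val_eval_eq w hA0
  obtain ⟨MB, hMB⟩ := exists_val_eval_eq w hBm.ne_zero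
  have hone_le_inv : (1 : ℝ≥0) ≤ (w (p : L))⁻¹ := one_le_inv_iff₀.mpr ⟨hppos, hpw.le⟩
  have hone_lt_inv : (1 : ℝ≥0) < (w (p : L))⁻¹ := one_lt_inv_iff₀.mpr ⟨hppos, hpw⟩
  have hlc1 : (1 : ℝ≥0) ≤ w A.leadingCoeff := le_trans (one_le_pow₀ hone_le_inv) hκ
  have hκμ : w A.leadingCoeff = w μ := by
    -- a deep point `P₀ = (x₀, y₀)` with `|x₀| > max (MA, MB, 1, |ρ|)`
    obtain ⟨N, hN⟩ : ∃ N : ℕ, max (max MA MB) (max 1 (w ρ)) < (w (p : L))⁻¹ ^ N :=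
      pow_unbounded_of_one_lt _ hone_lt_inv
    set x₀ : L := ((p : L) ^ N)⁻¹ with hx₀
    have hwx₀ : w x₀ = (w (p : L))⁻¹ ^ N := by rw [hx₀, map_inv₀, map_pow, inv_pow]
    obtain ⟨y₀, hy₀⟩ : ∃ y₀ : L, V.toAffine.Nonsingular x₀ y₀ := by
      set q : L[X] := C 1 * X ^ 2 + C (V.toAffine.a₁ * x₀ + V.toAffine.a₃) * X +
        C (-(x₀ ^ 3 + V.toAffine.a₂ * x₀ ^ 2 + V.toAffine.a₄ * x₀ + V.toAffine.a₆)) with hq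
      have hqdeg : q.degree = 2 := by rw [hq]; exact Polynomial.degree_quadratic one_ne_zero
      obtain ⟨y, hy⟩ := IsAlgClosed.exists_root q (by rw [hqdeg]; norm_num)
      refine ⟨y, (WeierstrassCurve.Affine.equation_iff_nonsingular (W := V.toAffine)).mp ?_⟩
      rw [WeierstrassCurve.Affine.equation_iff]
      rw [IsRoot, hq] at hy
      simp only [eval_add, eval_mul, eval_C, eval_pow, eval_X, one_mul] at hy
      linear_combination hy
    have hlt : ∀ t, t ≤ max (max MA MB) (max 1 (w ρ)) → t < w x₀ := fun t ht ↦
      lt_of_le_of_lt ht (hwx₀ ▸ hN)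
    have hx₀1 : 1 < w x₀ := hlt 1 (le_trans (le_max_left _ _) (le_max_right _ _))
    have hx₀0 : w x₀ ≠ 0 := fun h0 ↦ by rw [h0] at hx₀1; exact not_lt_zero hx₀1
    have hP₀S : (.some x₀ y₀ hy₀ : V.toAffine.Point) ∉ S := fun hmem ↦
      hSint _ hmem (some_mem_kernel hy₀ hx₀1)
    obtain ⟨hB0, y', h', hg⟩ := hform x₀ y₀ hy₀ hP₀S
    obtain ⟨x'', y'', h'', hg', hx''⟩ := hcoord x₀ y₀ hy₀ hP₀S
    rw [hg] at hg'
    obtain ⟨hxx, -⟩ := WeierstrassCurve.Affine.Point.some.inj hg'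
    have hval : w (A.eval x₀ / B.eval x₀) = w A.leadingCoeff * w x₀ := by
      rw [map_div₀, hMA x₀ (hlt MA (le_trans (le_max_left _ _) (le_max_left _ _))),
        hMB x₀ (hlt MB (le_trans (le_max_right _ _) (le_max_left _ _))), hBm.leadingCoeff, map_one,
        one_mul, hdeg, pow_succ, mul_comm (w x₀ ^ B.natDegree) (w x₀), ← mul_assoc, mul_div_assoc,
        div_self (pow_ne_zero _ hx₀0), mul_one]
    -- `μ · Xs P₀ = A/B - ρ` has valuation `|lc A| |x₀|`
    have hX₀ : w (Xs (.some x₀ y₀ hy₀)) = w x₀ := hXker x₀ y₀ hy₀ hx₀1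
    have hμX : μ * Xs (.some x₀ y₀ hy₀) = A.eval x₀ / B.eval x₀ - ρ := by
      rw [hxx, hx'']; ring
    have hρlt : w ρ < w (A.eval x₀ / B.eval x₀) := by
      rw [hval]
      calc w ρ < w x₀ := hlt _ (le_trans (le_max_right _ _) (le_max_right _ _))
        _ = 1 * w x₀ := (one_mul _).symm
        _ ≤ w A.leadingCoeff * w x₀ := mul_le_mul' hlc1 le_rfl
    have h1 : w (μ * Xs (.some x₀ y₀ hy₀)) = w A.leadingCoeff * w x₀ := by
      rw [hμX, Valuation.map_sub_eq_of_lt_left w hρlt, hval]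
    rw [map_mul, hX₀] at h1
    exact (mul_left_injective₀ hx₀0 h1).symm
  -- (d) the canonical-subgroup point `T_c` and its image
  obtain ⟨xc, yc, hc, hpc, hxc⟩ := V.exists_prime_zsmul_eq_zero_one_lt hp2 hpL hpw hd
  have hcS : (.some xc yc hc : V.toAffine.Point) ∉ S := fun hmem ↦
    hSint _ hmem (some_mem_kernel hc hxc)
  obtain ⟨x', y', h', hgc, hx'⟩ := hcoord xc yc hc hcS
  obtain ⟨x'T, y'T, h'T, hgT, hx'T⟩ := hcoord xT yT hT hTS
  -- `p • g(T_c) = 0`, so `|x'| ≤ |p|⁻¹`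
  have hpgc : (p : ℤ) • (.some x' y' h' : V'.toAffine.Point) = 0 := by
    rw [← hgc, ← map_zsmul, hpc, map_zero]
  have hx'le : w x' ≤ (w (p : L))⁻¹ := by
    by_cases hx1 : 1 < w x'
    · have hlev := V'.mul_pow_eq_one_of_prime_zsmul_eq_zero_of_one_lt hp2 hpL hcoef' hd' hhigh' hpgc hx1
      have hk1 : 1 ≤ (p - 1) / 2 := by
        have := hpP.two_le; rw [hk2]; omega
      have hpow : w x' ≤ w x' ^ ((p - 1) / 2) := le_self_pow₀ hx1.le (by omega)
      have heq : w x' ^ ((p - 1) / 2) = (w (p : L))⁻¹ := eq_inv_of_mul_eq_one_right hlev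
      rw [← heq]; exact hpow
    · rw [not_lt] at hx1
      exact hx1.trans hone_le_inv
  -- `2 • g(T) = 0`, so `|x'T| ≤ 1`
  have h2gT : (2 : ℤ) • (.some x'T y'T h'T : V'.toAffine.Point) = 0 := by
    rw [← hgT, ← map_zsmul, hT2, map_zero]
  have hwx'T : w x'T ≤ 1 := val_le_one_of_zsmul_eq_zero (V := V') h2z h2gT
  -- `x' - x'T = μ (X T_c - X T)` has valuation `|μ| |x_c| ≥ |p|⁻² |x_c| > |p|⁻²`
  have hdiff : x' - x'T = μ * (Xs (.some xc yc hc) - Xs (.some xT yT hT)) := by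
    rw [hx', hx'T]; ring
  have hXc : w (Xs (.some xc yc hc)) = w xc := hXker xc yc hc hxc
  have hXdiff : w (Xs (.some xc yc hc) - Xs (.some xT yT hT)) = w xc := by
    rw [Valuation.map_sub_eq_of_lt_left w (by rw [hXc]; exact lt_of_le_of_lt hXT hxc), hXc]
  have hwdiff : (w (p : L))⁻¹ ^ 2 < w (x' - x'T) := by
    rw [hdiff, map_mul, hXdiff, ← hκμ]
    calc (w (p : L))⁻¹ ^ 2 = (w (p : L))⁻¹ ^ 2 * 1 := (mul_one _).symm
      _ < (w (p : L))⁻¹ ^ 2 * w xc := mul_lt_mul_of_pos_left hxc (pow_pos (inv_pos.mpr hppos) 2)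
      _ ≤ w A.leadingCoeff * w xc := mul_le_mul' hκ le_rfl
  have hwx' : (w (p : L))⁻¹ ^ 2 < w x' := by
    have h1 : w x'T < w (x' - x'T) := lt_of_le_of_lt hwx'T
      (lt_trans (one_lt_pow₀ hone_lt_inv two_ne_zero) hwdiff)
    have : x' = (x' - x'T) + x'T := by ring
    rw [this, Valuation.map_add_eq_of_lt_left w h1]
    exact hwdiff
  -- but `|x'| ≤ |p|⁻¹ < |p|⁻²`
  have hlt : (w (p : L))⁻¹ < (w (p : L))⁻¹ ^ 2 := by
    rw [sq]
    exact lt_mul_of_one_lt_left (inv_pos.mpr hppos) hone_lt_inv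
  exact absurd (lt_of_lt_of_le (lt_trans hlt hwx') hx'le) (lt_irrefl _)

end Summit.BirchSwinnertonDyer.Rank1Residual.X2.IsogenyPeriodRatioCore

end
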